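import Mathlib
import HarnessLib
import Summits.HubbardSuperconductivity.HubbardSuperconductivity.Theorems.WeakCouplingBCSDefsKlCertB1gD020CellRecord
import Summits.HubbardSuperconductivity.HubbardSuperconductivity.Theorems.WeakCouplingBCSDefsKlU0D020CellRecord
import Summits.HubbardSuperconductivity.HubbardSuperconductivity.Theorems.WeakCouplingBCSKlSelectionWindowRows

/-!
# Route `WeakCouplingBCS` — channel-margin lane of `WcbcsKohnLuttingerB1g` (stmt-HubbardSuperconductivity-0158):
# `B1g` SELECTION THROUGH THIRD ORDER / RESUMMED CHAINS / ALL ORDERS / CHANNEL BOTTOMS ON THE `δ ≈ 0.20` CELL, against the tree record `klCertB1gD020Cell`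

Instances of the generic window-rows theorems (`klThirdOrder_selection_windowRows`, `Theorems/WeakCouplingBCSKlThirdOrderSelectionWindow.lean`;
`klResummed_selection_windowRows`, `klAllOrders_selection_windowRows`, `klThirdOrder_lt_channelInf3_windowRows`, `klThirdOrder_channelInf3_lt_windowRows`,
`Theorems/WeakCouplingBCSKlSelectionWindowRows.lean`) for the one-row record `klU0D020CellRows` (`Theorems/WeakCouplingBCSDefsKlU0D020CellRecord.lean`) against
the second-order window record `klCertB1gD020Cell` (`Theorems/WeakCouplingBCSDefsKlCertB1gD020CellRecord.lean`, box `[-0.42918, -0.4242]` ∋ μ(0.20) ≈ -0.4267):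
for EVERY `μ` of that box and every `0 < U ≤ klU0D020CellU` the `B1g` Ritz trial of the record lies strictly below every normalised `A1g/A2g/B2g/E` state in
the pp-irreducible Cooper vertex `Γ_U/U²` through third order (chains resummed; to all orders for every remainder with the `C4 = 10` form bound), and `B1g`
has the strictly lowest third-order channel bottom — modulo the NAMED hypotheses `klCertB1gD020Cell.EnclosuresB1g` (second order, margin-2, MU-WINDOW.md;
certified in two implementations) and the row's named third-order / resummed window hypotheses (margin-1 FLOOR + chain layer, two implementations,
U0-TABLE.md v4 §A).  This replaces, at theorem level, the δ ≈ 0.20 threshold 4267/2²⁴ ≈ 2.5·10⁻⁴ of the box-wise row `klU0w00` (wide-cell allowances)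
by the narrow-cell threshold `klU0D020CellU` on a box that contains μ(0.20).  Existence-grade numbers; `C4` ASSUMED; nothing here asserts superconductivity.

References: D. J. Scalapino, E. Loh, J. E. Hirsch, Phys. Rev. B 34 (1986) 8190, (3)–(4); S. Raghu, S. A. Kivelson, D. J. Scalapino,
Phys. Rev. B 81 (2010) 224505, App. A.
-/

noncomputable section

-- the tree's namespace `Summit.<Summit>.<Problem>.Theorems` repeats the summit name by design (D-0017)
set_option linter.dupNamespace false

namespace Summit.HubbardSuperconductivity.HubbardSuperconductivity.Theorems

open MeasureTheory Literature.MathematicalPhysics.QuantumLattice CwKLChiralWindow KlThirdOrder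
open Summit.HubbardSuperconductivity.HubbardSuperconductivity.Theses.WeakCouplingBCS

/-- Kernel decision: every row of `klU0D020CellRows` sits in a box of `klCertB1gD020Cell` with which it is consistent (its box inside the record box,
same `rhohi`, lows dominated by the box's certified lower bounds, four competitors, `U1 ≤ 1`). [folklore] -/
theorem klsel_d020cell_join : klThirdOrderWindowJoin klU0D020CellRows [klCertB1gD020Cell] = true := by
  decide +kernel

/-- The records pass the multiplicity-aware checker (kernel decisions of their record files) and carry their enclosures. [folklore] -/
theorem klsel_d020cell_recs (hA : klCertB1gD020Cell.EnclosuresB1g) :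
    ∀ c ∈ [klCertB1gD020Cell], c.checkB1gD = true ∧ c.EnclosuresB1g := by
  intro c hc
  simp only [List.mem_cons, List.mem_nil_iff, or_false] at hc
  subst hc
  exact ⟨klCertB1gD020Cell_check, hA⟩

/-- Kernel decision: every row of `klU0D020CellRows` carries `C4 = 10` and `U1 = 1/16`. [folklore] -/
theorem klsel_d020cell_consts :
    (klU0D020CellRows.all fun w => decide (w.row.C4 = (10 : ℚ)) && decide (w.row.U1 = ((1 : ℚ) / 16))) = true := by
  decide +kernel

/-- **`B1g` selection survives the complete THIRD ORDER of the pp-irreducible Cooper vertex for every `μ ∈ [-0.42918, -0.4242]`** and every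
`0 < U ≤ klU0D020CellU`: some `B1g` channel state on `F_μ` lies strictly below every normalised `A1g`, `A2g`, `B2g`, `E` state of `thirdOrderForm ε₀ μ U` —
modulo the NAMED numerical hypotheses `klCertB1gD020Cell.EnclosuresB1g` (second order; certified interval computation of the cell's
window lanes) and the named window hypotheses of `klU0D020CellRows` (third order / resummed chains; certified in two interval implementations on every box,
U0-TABLE.md v4).  Existence-grade threshold; nothing here asserts a pairing instability. [cite: RaghuKivelsonScalapino2010, App. A] -/
theorem klThirdOrder_selection_d020cell (hA : klCertB1gD020Cell.EnclosuresB1g)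
    (h3 : KlThirdOrderWindowEnclosures klU0D020CellRows [klCertB1gD020Cell]) :
    ∀ μ : ℝ, ((((-21459 : ℚ) / 50000) : ℚ) : ℝ) ≤ μ → μ ≤ ((((-2121 : ℚ) / 5000) : ℚ) : ℝ) →
      ∃ ψ : Momentum → ℝ, IsChannelState (squareDispersion 1 0) μ D4Irrep.B1g ψ ∧
        ∀ U : ℝ, 0 < U → U ≤ ((klU0D020CellU : ℚ) : ℝ) → ∀ χ : D4Irrep, χ ≠ D4Irrep.B1g →
          ∀ φ : Momentum → ℝ, IsChannelState (squareDispersion 1 0) μ χ φ →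
            thirdOrderForm (squareDispersion 1 0) μ U ψ < thirdOrderForm (squareDispersion 1 0) μ U φ :=
  klThirdOrder_selection_windowRows klU0D020CellRows _ _ _ _ klU0D020CellRows_check klsel_d020cell_join (klsel_d020cell_recs hA) h3

/-- **`B1g` selection with the chains RESUMMED, every `μ ∈ [-0.42918, -0.4242]`, `0 < U ≤ klU0D020CellU`** —
modulo the NAMED numerical hypotheses `klCertB1gD020Cell.EnclosuresB1g` (second order; certified interval computation of the cell's
window lanes) and the named window hypotheses of `klU0D020CellRows` (third order / resummed chains; certified in two interval implementations on every box,
U0-TABLE.md v4).  Existence-grade threshold; nothing here asserts a pairing instability. [cite: ScalapinoLohHirsch1986, (3)-(4)] -/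
theorem klResummed_selection_d020cell (hA : klCertB1gD020Cell.EnclosuresB1g)
    (h3 : KlResummedWindowEnclosures klU0D020CellRows [klCertB1gD020Cell]) :
    ∀ μ : ℝ, ((((-21459 : ℚ) / 50000) : ℚ) : ℝ) ≤ μ → μ ≤ ((((-2121 : ℚ) / 5000) : ℚ) : ℝ) →
      ∃ ψ : Momentum → ℝ, IsChannelState (squareDispersion 1 0) μ D4Irrep.B1g ψ ∧
        ∀ U : ℝ, 0 < U → U ≤ ((klU0D020CellU : ℚ) : ℝ) → ∀ χ : D4Irrep, χ ≠ D4Irrep.B1g →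
          ∀ φ : Momentum → ℝ, IsChannelState (squareDispersion 1 0) μ χ φ →
            resummedForm (squareDispersion 1 0) μ U ψ < resummedForm (squareDispersion 1 0) μ U φ :=
  klResummed_selection_windowRows klU0D020CellRows _ _ _ _ klU0D020CellRows_check klsel_d020cell_join (klsel_d020cell_recs hA) h3

/-- **`B1g` selection to ALL ORDERS, every `μ ∈ [-0.42918, -0.4242]`, `0 < U ≤ klU0D020CellU`**, for EVERY coupling-dependent remainder kernel `R`
(read: the non-chain diagrams of order `≥ 4` of `Γ_U/U⁴`) whose form is `≤ 10‖Φ_B‖²` on the `B1g` trial of every record box and `≥ -10` on normalised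
competitor states for `0 < U ≤ 1/16` — the rows' ASSUMED `C4 = 10` column as a theorem;
modulo the NAMED numerical hypotheses `klCertB1gD020Cell.EnclosuresB1g` (second order; certified interval computation of the cell's
window lanes) and the named window hypotheses of `klU0D020CellRows` (third order / resummed chains; certified in two interval implementations on every box,
U0-TABLE.md v4).  Existence-grade threshold; nothing here asserts a pairing instability. [cite: RaghuKivelsonScalapino2010, App. A] -/
theorem klAllOrders_selection_d020cell (hA : klCertB1gD020Cell.EnclosuresB1g)
    (h3 : KlResummedWindowEnclosures klU0D020CellRows [klCertB1gD020Cell])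
    (R : ℝ → Momentum → Momentum → ℝ)
    (hRB : ∀ c ∈ [klCertB1gD020Cell], ∀ bx ∈ c.boxes, ∀ μ : ℝ,
      ((bx.mulo : ℚ) : ℝ) ≤ μ → μ ≤ ((bx.muhi : ℚ) : ℝ) → ∀ U : ℝ, 0 < U → U ≤ ((((1 : ℚ) / 16) : ℚ) : ℝ) →
        kform (fermiCurveMeasure (squareDispersion 1 0) μ) (R U) (bx.bB1g.trialFun c.trials) ≤
          (((10 : ℚ) : ℚ) : ℝ) * ∫ k, bx.bB1g.trialFun c.trials k ^ 2 ∂fermiCurveMeasure (squareDispersion 1 0) μ)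
    (hRχ : ∀ μ : ℝ, ((((-21459 : ℚ) / 50000) : ℚ) : ℝ) ≤ μ → μ ≤ ((((-2121 : ℚ) / 5000) : ℚ) : ℝ) →
      ∀ U : ℝ, 0 < U → U ≤ ((((1 : ℚ) / 16) : ℚ) : ℝ) → ∀ χ : D4Irrep, χ ≠ D4Irrep.B1g →
        ∀ φ : Momentum → ℝ, IsChannelState (squareDispersion 1 0) μ χ φ →
          -(((10 : ℚ) : ℚ) : ℝ) ≤ kform (fermiCurveMeasure (squareDispersion 1 0) μ) (R U) φ) :
    ∀ μ : ℝ, ((((-21459 : ℚ) / 50000) : ℚ) : ℝ) ≤ μ → μ ≤ ((((-2121 : ℚ) / 5000) : ℚ) : ℝ) →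
      ∃ ψ : Momentum → ℝ, IsChannelState (squareDispersion 1 0) μ D4Irrep.B1g ψ ∧
        ∀ U : ℝ, 0 < U → U ≤ ((klU0D020CellU : ℚ) : ℝ) → ∀ χ : D4Irrep, χ ≠ D4Irrep.B1g →
          ∀ φ : Momentum → ℝ, IsChannelState (squareDispersion 1 0) μ χ φ →
            resummedForm (squareDispersion 1 0) μ U ψ + U ^ 2 * kform (fermiCurveMeasure (squareDispersion 1 0) μ) (R U) ψ <
              resummedForm (squareDispersion 1 0) μ U φ + U ^ 2 * kform (fermiCurveMeasure (squareDispersion 1 0) μ) (R U) φ :=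
  klAllOrders_selection_windowRows klU0D020CellRows _ _ _ _ _ _ klU0D020CellRows_check klsel_d020cell_join (klsel_d020cell_recs hA) h3
    klsel_d020cell_consts R hRB hRχ

/-- **The `B1g` trial lies strictly below every competitor's third-order CHANNEL BOTTOM `channelInf3 ε₀ μ U χ`, every `μ ∈ [-0.42918, -0.4242]`,
`0 < U ≤ klU0D020CellU`** — modulo the NAMED numerical hypotheses `klCertB1gD020Cell.EnclosuresB1g` (second order; certified interval computation of the cell's
window lanes) and the named window hypotheses of `klU0D020CellRows` (third order / resummed chains; certified in two interval implementations on every box,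
U0-TABLE.md v4).  Existence-grade threshold; nothing here asserts a pairing instability. [cite: RaghuKivelsonScalapino2010, App. A] -/
theorem klThirdOrder_lt_channelInf3_d020cell (hA : klCertB1gD020Cell.EnclosuresB1g)
    (h3 : KlThirdOrderWindowEnclosures klU0D020CellRows [klCertB1gD020Cell]) :
    ∀ μ : ℝ, ((((-21459 : ℚ) / 50000) : ℚ) : ℝ) ≤ μ → μ ≤ ((((-2121 : ℚ) / 5000) : ℚ) : ℝ) →
      ∃ ψ : Momentum → ℝ, IsChannelState (squareDispersion 1 0) μ D4Irrep.B1g ψ ∧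
        ∀ U : ℝ, 0 < U → U ≤ ((klU0D020CellU : ℚ) : ℝ) → ∀ χ : D4Irrep, χ ≠ D4Irrep.B1g →
          thirdOrderForm (squareDispersion 1 0) μ U ψ < channelInf3 (squareDispersion 1 0) μ U χ :=
  klThirdOrder_lt_channelInf3_windowRows klU0D020CellRows _ _ _ _ klU0D020CellRows_check klsel_d020cell_join (klsel_d020cell_recs hA) h3

/-- **`B1g` has the strictly lowest third-order channel bottom, every `μ ∈ [-0.42918, -0.4242]`, `0 < U ≤ klU0D020CellU`, every `χ ∈ {A1g, A2g, B2g, E}`: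
`channelInf3 ε₀ μ U B1g < channelInf3 ε₀ μ U χ`** — modulo the NAMED numerical hypotheses `klCertB1gD020Cell.EnclosuresB1g` (second order; certified interval computation of the cell's
window lanes) and the named window hypotheses of `klU0D020CellRows` (third order / resummed chains; certified in two interval implementations on every box,
U0-TABLE.md v4).  Existence-grade threshold; nothing here asserts a pairing instability.  The extra named hypothesis is, per row, its `A2g` datum READ ON THE `B1g`
STATES (`(w.row.chanOf A2g).ThirdOrderLowerBound μ B1g`): the rows' even-channel data `s3 = ‖2x̄²‖_HS`, `t = ‖N̄_V+N̄_P‖_HS` are channel-independent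
Hilbert–Schmidt numbers, valid on every even state, hence on `B1g`. [cite: RaghuKivelsonScalapino2010, App. A] -/
theorem klThirdOrder_channelInf3_lt_d020cell (hA : klCertB1gD020Cell.EnclosuresB1g)
    (h3 : KlThirdOrderWindowEnclosures klU0D020CellRows [klCertB1gD020Cell])
    (hB1g : ∀ w ∈ klU0D020CellRows, ∀ μ : ℝ, ((w.mulo : ℚ) : ℝ) ≤ μ → μ ≤ ((w.muhi : ℚ) : ℝ) →
      (w.row.chanOf D4Irrep.A2g).ThirdOrderLowerBound μ D4Irrep.B1g) :
    ∀ μ : ℝ, ((((-21459 : ℚ) / 50000) : ℚ) : ℝ) ≤ μ → μ ≤ ((((-2121 : ℚ) / 5000) : ℚ) : ℝ) →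
      ∀ U : ℝ, 0 < U → U ≤ ((klU0D020CellU : ℚ) : ℝ) → ∀ χ : D4Irrep, χ ≠ D4Irrep.B1g →
        channelInf3 (squareDispersion 1 0) μ U D4Irrep.B1g < channelInf3 (squareDispersion 1 0) μ U χ :=
  klThirdOrder_channelInf3_lt_windowRows klU0D020CellRows _ _ _ _ klU0D020CellRows_check klsel_d020cell_join (klsel_d020cell_recs hA) h3 hB1g

end Summit.HubbardSuperconductivity.HubbardSuperconductivity.Theorems

end
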